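import Summits.Ventures.PercRepro.RankLevelSetHallRuleCDefs

/-!
# PercRepro — RULE C: EVERY MEMBER RECEIVES EXACTLY `Φ(p,q)`, AND THE UP-HALL FORM AT THE TIGHT LAYER REDUCES TO ONE
PER-SET LOAD INEQUALITY (p4, gen 32; C-044, UP form; paper proofs/P4-CELL-THREE.md §14.19)

With the definitions of RankLevelSetHallRuleCDefs: the big-set receipt of a member under Rule C is its LYM defect to the
digit — `ruleCBig Z = δ(Z)` (`ruleCBig_eq_lymDefect`: the `p`-sets `S ∈ Y` through `Z` meeting its flat part are exactly the
sets `Z ∪ X ∪ Y` of the pairs `(X, Y)`, `∅ ≠ X ⊆ P` with `#X ≤ k−1`, `Y ⊆ D` with `#Y = k − #X`, each weighted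
`1/(C(q+#X,q)·C(#D,k−#X))`, and the `C(#D, k−#X)` sets of one `X` return `1/C(q+#X, q)`), so with night-1's `ruleLMid_eq`
**every member receives exactly `Φ(p,q)`** (`ruleCRecv_eq_phiK`), and **`LoadC M p q` gives the UP-Hall condition for every
family of members** (`hallUp_of_ncard_eq_of_loadC`, through night-1's `hallUp_of_fracMatching`).  `LoadC` is NOT asserted:
it is false in general (the paper's §14.19 families — k = 2: load `(q−j)/(q+1)·(1/3 + (j+1)/(j+3))`, above `1` from `q ≈ 75`;
k = 3: a six-level design with load `→ ≈ 1.15`), true on every matroid with at most 8 elements.  What the failure shows: a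
certificate of the UP form must draw on the big sets of ALL sizes, as Rule L does.  Axioms: standard.
-/

namespace PercRepro

open Set Matroid Finset

variable {α : Type} (M : Matroid α) [M.Finite]

/-- **The big-set receipt of Rule C is the LYM defect**: at the tight layer, `ruleCBig Z = δ(Z)` for every member. -/
theorem ruleCBig_eq_lymDefect (p q : ℕ) (hE : M.E.ncard = p + q) (hpq : q < p) {Z : Set α}
    (hZ : Z ∈ cellMembers M p q) : ruleCBig M p q Z = lymDefect M p q Z := by
  classical
  -- the data of the member
  have hZE : Z ⊆ M.E := hZ.1
  have hEfin : M.E.Finite := M.ground_finite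
  have hZfin : Z.Finite := hEfin.subset hZE
  have hZcard : Z.ncard = q := ncard_eq_q_of_mem_cellMembers_tight M hE hZ
  have hAfin : (M.E \ Z).Finite := hEfin.subset Set.sdiff_subset
  have hPsub : flatPart M Z ⊆ M.E \ Z := fun x hx => hx.1
  have hDsub : freePart M Z ⊆ M.E \ Z := fun x hx => hx.1
  have hPfin : (flatPart M Z).Finite := hAfin.subset hPsub
  have hDfin : (freePart M Z).Finite := hAfin.subset hDsub
  have hPD : Disjoint (flatPart M Z) (freePart M Z) := disjoint_flatPart_freePart M Z
  have hPcl : flatPart M Z ⊆ M.closure Z := fun x hx => hx.2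
  have hsum := ncard_freePart_add_ncard_flatPart M hE hZ
  set k := p - q with hk
  set m := (flatPart M Z).ncard with hm
  have hDcard : (freePart M Z).ncard = p - m := by omega
  have hmq : m ≤ q := by
    have h2 := (compl_indep_of_mem_U M hE hZ).1
    have h3 : M.eRk (flatPart M Z) = (m : ℕ∞) := by
      rw [(h2.subset hPsub).eRk_eq_encard, hPfin.cast_ncard_eq]
    have h4 : M.eRk (flatPart M Z) ≤ M.eRk (M.closure Z) := M.eRk_mono hPcl
    rw [h3, M.eRk_closure_eq, hZ.2.1] at h4
    exact_mod_cast h4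
  set Pf : Finset α := hPfin.toFinset with hPf
  set Df : Finset α := hDfin.toFinset with hDf
  have hPfcard : Pf.card = m := by rw [hPf, ← ncard_eq_toFinset_card _ hPfin]
  have hDfcard : Df.card = p - m := by rw [hDf, ← ncard_eq_toFinset_card _ hDfin, hDcard]
  have hqZ : M.eRk Z = (q : ℕ∞) := hZ.2.1
  have hmemP : ∀ X : Finset α, X ⊆ Pf → (X : Set α) ⊆ flatPart M Z := fun X hXP x hx => by
    have := hXP hx; rwa [hPf, hPfin.mem_toFinset] at this
  have hmemD : ∀ Y : Finset α, Y ⊆ Df → (Y : Set α) ⊆ freePart M Z := fun Y hYD y hy => by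
    have := hYD hy; rwa [hDf, hDfin.mem_toFinset] at this
  -- the index finset: pairs (X, Y), X ⊆ P with 1 ≤ #X < k, Y ⊆ D with #Y = k − #X
  set Idx : Finset (Σ _ : Finset α, Finset α) :=
    (Pf.powerset.filter (fun X => 1 ≤ X.card ∧ X.card < k)).sigma (fun X => Df.powersetCard (k - X.card)) with hIdx
  -- the membership facts of a pair, in the vocabulary of the index finset
  have hpair : ∀ (X Y : Finset α), X ⊆ Pf → 1 ≤ X.card → X.card < k → Y ⊆ Df → Y.card = k - X.card →
      Z ∪ (X : Set α) ∪ (Y : Set α) ∈ cellY M p q ∧ (Z ∪ (X : Set α) ∪ (Y : Set α)).ncard = p ∧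
      (Z ∪ (X : Set α) ∪ (Y : Set α)) ∩ flatPart M Z = (X : Set α) ∧
      (Z ∪ (X : Set α) ∪ (Y : Set α)) ∩ freePart M Z = (Y : Set α) := by
    intro X Y hXP hX1 hXk hYD hYcard
    refine pair_mem_bigSets M p q hE hpq hZ (hmemP X hXP) (hmemD Y hYD) ?_ ?_ ?_
    · rw [Set.ncard_coe_finset]; exact hX1
    · rw [Set.ncard_coe_finset]; exact hXk
    · rw [Set.ncard_coe_finset, Set.ncard_coe_finset, hYcard]
  -- the big-set receipt as a sum over the index finset
  have hbig : ruleCBig M p q Z = ∑ XY ∈ Idx,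
      1 / ((((q + XY.1.card).choose q : ℕ) : ℚ) * (((p - m).choose (k - XY.1.card) : ℕ) : ℚ)) := by
    unfold ruleCBig
    rw [← Finset.sum_filter_add_sum_filter_not (cellY_finite M p q).toFinset
      (fun S => Z ⊆ S ∧ S.ncard = p ∧ (S ∩ flatPart M Z).Nonempty)]
    have hzero : ∑ S ∈ (cellY_finite M p q).toFinset.filter
        (fun S => ¬ (Z ⊆ S ∧ S.ncard = p ∧ (S ∩ flatPart M Z).Nonempty)), ruleCBigWeight M p q Z S = 0 := by
      refine Finset.sum_eq_zero (fun S hS => ?_)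
      rw [Finset.mem_filter] at hS
      unfold ruleCBigWeight
      rw [if_neg (fun hc => hS.2 ⟨hc.2.1, hc.2.2.2.1, hc.2.2.2.2⟩)]
    rw [hzero, add_zero]
    symm
    refine Finset.sum_bij (fun XY _ => Z ∪ (XY.1 : Set α) ∪ (XY.2 : Set α)) ?_ ?_ ?_ ?_
    · -- maps into the p-sets of Y through Z meeting the flat part
      rintro ⟨X, Y⟩ hXY
      rw [hIdx, Finset.mem_sigma, Finset.mem_filter, Finset.mem_powerset, Finset.mem_powersetCard] at hXY
      dsimp only at hXY
      obtain ⟨⟨hXP, hX1, hXk⟩, hYD, hYcard⟩ := hXY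
      obtain ⟨hSY, hScard, hSX, -⟩ := hpair X Y hXP hX1 hXk hYD hYcard
      rw [Finset.mem_filter, (cellY_finite M p q).mem_toFinset]
      refine ⟨hSY, Set.subset_union_left.trans Set.subset_union_left, hScard, ?_⟩
      rw [hSX]
      obtain ⟨x, hx⟩ := Finset.card_pos.1 (show 0 < X.card by omega)
      exact ⟨x, hx⟩
    · -- injective: X = S ∩ P, Y = S ∩ D
      rintro ⟨X₁, Y₁⟩ hXY₁ ⟨X₂, Y₂⟩ hXY₂ heq
      rw [hIdx, Finset.mem_sigma, Finset.mem_filter, Finset.mem_powerset, Finset.mem_powersetCard] at hXY₁ hXY₂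
      dsimp only at hXY₁ hXY₂ heq
      obtain ⟨-, -, h1X, h1Y⟩ := hpair X₁ Y₁ hXY₁.1.1 hXY₁.1.2.1 hXY₁.1.2.2 hXY₁.2.1 hXY₁.2.2
      obtain ⟨-, -, h2X, h2Y⟩ := hpair X₂ Y₂ hXY₂.1.1 hXY₂.1.2.1 hXY₂.1.2.2 hXY₂.2.1 hXY₂.2.2
      have hX : (X₁ : Set α) = (X₂ : Set α) := by rw [← h1X, ← h2X, heq]
      have hY : (Y₁ : Set α) = (Y₂ : Set α) := by rw [← h1Y, ← h2Y, heq]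
      rw [Finset.coe_inj] at hX hY
      subst hX; subst hY; rfl
    · -- surjective
      intro S hS
      rw [Finset.mem_filter, (cellY_finite M p q).mem_toFinset] at hS
      obtain ⟨⟨hSE, hqS, hSp⟩, hZS, hScard, hSP⟩ := hS
      have hSfin : S.Finite := hEfin.subset hSE
      have hXfin : (S ∩ flatPart M Z).Finite := hSfin.subset Set.inter_subset_left
      have hYfin : (S ∩ freePart M Z).Finite := hSfin.subset Set.inter_subset_left
      -- S = Z ⊔ (S ∩ P) ⊔ (S ∩ D)
      have hdecomp : S = Z ∪ (S ∩ flatPart M Z) ∪ (S ∩ freePart M Z) := by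
        ext x
        constructor
        · intro hx
          by_cases hxZ : x ∈ Z
          · exact Or.inl (Or.inl hxZ)
          · have hxA : x ∈ M.E \ Z := ⟨hSE hx, hxZ⟩
            rw [← flatPart_union_freePart M Z] at hxA
            rcases hxA with hxP | hxD
            · exact Or.inl (Or.inr ⟨hx, hxP⟩)
            · exact Or.inr ⟨hx, hxD⟩
        · rintro ((hxZ | hxP) | hxD)
          · exact hZS hxZ
          · exact hxP.1
          · exact hxD.1
      have hdisj1 : Disjoint Z (S ∩ flatPart M Z) := Set.disjoint_left.2 (fun x hxZ hx => (hPsub hx.2).2 hxZ)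
      have hdisj2 : Disjoint (Z ∪ (S ∩ flatPart M Z)) (S ∩ freePart M Z) := by
        rw [Set.disjoint_union_left]
        exact ⟨Set.disjoint_left.2 (fun x hxZ hx => (hDsub hx.2).2 hxZ),
          Set.disjoint_left.2 (fun x hx hx' => Set.disjoint_left.1 hPD hx.2 hx'.2)⟩
      have hcards : Z.ncard + (S ∩ flatPart M Z).ncard + (S ∩ freePart M Z).ncard = p := by
        rw [← hScard, hdecomp, Set.ncard_union_eq hdisj2 (hZfin.union hXfin) hYfin,
          Set.ncard_union_eq hdisj1 hZfin hXfin, ← hdecomp]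
      have hXlt : (S ∩ flatPart M Z).ncard < k := by
        by_contra hge
        have hY0 : (S ∩ freePart M Z).ncard = 0 := by omega
        rw [Set.ncard_eq_zero hYfin] at hY0
        have hScl : S ⊆ M.closure Z := by
          rw [hdecomp, hY0, Set.union_empty]
          exact Set.union_subset (M.subset_closure Z hZE) (fun x hx => hPcl hx.2)
        have : M.eRk S ≤ M.eRk Z := by
          calc M.eRk S ≤ M.eRk (M.closure Z) := M.eRk_mono hScl
            _ = M.eRk Z := M.eRk_closure_eq Z
        rw [hqZ] at this
        exact absurd hqS (not_lt.2 this)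
      have hX1 : 1 ≤ (S ∩ flatPart M Z).ncard := by
        rw [Nat.one_le_iff_ne_zero, Ne, Set.ncard_eq_zero hXfin]
        exact Set.nonempty_iff_ne_empty.1 hSP
      refine ⟨⟨hXfin.toFinset, hYfin.toFinset⟩, ?_, ?_⟩
      · rw [hIdx, Finset.mem_sigma, Finset.mem_filter, Finset.mem_powerset, Finset.mem_powersetCard]
        refine ⟨⟨?_, ?_, ?_⟩, ?_, ?_⟩
        · intro x hx
          rw [hXfin.mem_toFinset] at hx
          rw [hPf, hPfin.mem_toFinset]
          exact hx.2
        · rw [← ncard_eq_toFinset_card _ hXfin]; exact hX1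
        · rw [← ncard_eq_toFinset_card _ hXfin]; exact hXlt
        · intro y hy
          rw [hYfin.mem_toFinset] at hy
          rw [hDf, hDfin.mem_toFinset]
          exact hy.2
        · rw [← ncard_eq_toFinset_card _ hYfin, ← ncard_eq_toFinset_card _ hXfin]; omega
      · show Z ∪ ((hXfin.toFinset : Finset α) : Set α) ∪ ((hYfin.toFinset : Finset α) : Set α) = S
        rw [Set.Finite.coe_toFinset, Set.Finite.coe_toFinset]
        exact hdecomp.symm
    · -- the values agree
      rintro ⟨X, Y⟩ hXY
      rw [hIdx, Finset.mem_sigma, Finset.mem_filter, Finset.mem_powerset, Finset.mem_powersetCard] at hXY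
      dsimp only at hXY
      obtain ⟨⟨hXP, hX1, hXk⟩, hYD, hYcard⟩ := hXY
      obtain ⟨hSY, hScard, hSX, hSY'⟩ := hpair X Y hXP hX1 hXk hYD hYcard
      unfold ruleCBigWeight
      have hmemb : Z ∈ cellMembers M p q ∧ Z ⊆ Z ∪ (X : Set α) ∪ (Y : Set α) ∧
          Z ∪ (X : Set α) ∪ (Y : Set α) ∈ cellY M p q ∧ (Z ∪ (X : Set α) ∪ (Y : Set α)).ncard = p ∧
          ((Z ∪ (X : Set α) ∪ (Y : Set α)) ∩ flatPart M Z).Nonempty := by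
        refine ⟨hZ, Set.subset_union_left.trans Set.subset_union_left, hSY, hScard, ?_⟩
        rw [hSX]
        obtain ⟨x, hx⟩ := Finset.card_pos.1 (show 0 < X.card by omega)
        exact ⟨x, hx⟩
      rw [if_pos hmemb, hSX, hSY', Set.ncard_coe_finset, Set.ncard_coe_finset, hYcard, hDcard]
  -- sum over Y first: C(#D, k − #X) equal terms
  have hinner : ∀ X ∈ Pf.powerset.filter (fun X => 1 ≤ X.card ∧ X.card < k),
      ∑ Y ∈ Df.powersetCard (k - X.card),
        1 / ((((q + X.card).choose q : ℕ) : ℚ) * (((p - m).choose (k - X.card) : ℕ) : ℚ))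
      = 1 / (((q + X.card).choose q : ℕ) : ℚ) := by
    intro X hX
    rw [Finset.mem_filter, Finset.mem_powerset] at hX
    rw [Finset.sum_const, Finset.card_powersetCard, hDfcard, nsmul_eq_mul]
    have hpos : (0 : ℚ) < (((p - m).choose (k - X.card) : ℕ) : ℚ) := by
      exact_mod_cast Nat.choose_pos (by omega)
    field_simp
  rw [hbig, hIdx, Finset.sum_sigma, Finset.sum_congr rfl hinner, Finset.sum_filter]
  -- the sum over the subsets of the flat part
  have hP := sum_powerset_supported Pf k (fun j => 1 / (((q + j).choose q : ℕ) : ℚ))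
  rw [hP, hPfcard]
  unfold lymDefect
  rw [← hm, show p - q - 1 = k - 1 by omega]
  refine Finset.sum_congr rfl (fun i _ => ?_)
  rw [show q + (i + 1) = q + i + 1 by ring, mul_one_div]

/-- **Every member receives exactly `Φ(p,q)` under Rule C** (at the tight layer). -/
theorem ruleCRecv_eq_phiK (p q : ℕ) (hE : M.E.ncard = p + q) (hpq : q < p) {Z : Set α}
    (hZ : Z ∈ cellMembers M p q) : ruleCRecv M p q Z = phiK p q := by
  rw [ruleCRecv_eq_mid_add_big M p q hZ, ruleLMid_eq M p q hE hpq hZ, ruleCBig_eq_lymDefect M p q hE hpq hZ]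
  ring

/-- **The transfer**: at the tight layer `#E = p + q`, `LoadC M p q` gives the UP-Hall condition for every family of
members — Rule C is a fractional `Φ`-matching (exact receipts, loads at most `1`). -/
theorem hallUp_of_ncard_eq_of_loadC (p q : ℕ) (hE : M.E.ncard = p + q) (hpq : q < p) (h : LoadC M p q)
    (𝒜 : Set (Set α)) (h𝒜 : 𝒜 ⊆ cellMembers M p q) :
    phiK p q * (𝒜.ncard : ℚ) ≤ ((upNbhd M p q 𝒜).ncard : ℚ) := by
  refine hallUp_of_fracMatching M p q (ruleCWeight M p q) (ruleCWeight_nonneg M p q)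
    (subset_of_ruleCWeight_ne_zero M p q) ?_ (ruleCWeight_load_le_one M p q hE h) 𝒜 h𝒜
  intro Z hZ
  rw [show ∑ S ∈ (cellY_finite M p q).toFinset, ruleCWeight M p q Z S = ruleCRecv M p q Z from rfl,
    ruleCRecv_eq_phiK M p q hE hpq hZ]

end PercRepro
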